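import Summits.Ventures.PercRepro.MSTightLever

/-!
# The Daykin lever, other half: the `r`-members of a tight family

`MSTightLever.lean` shows that for a tight family `F` and an element `r` with
`|partr r F| ≤ |part0 r F|`, the `r`-free half `part0 r F` is tight. The same inequality
`|L| · |F₀| ≤ |L \\ F₀| · |F₀ \\ L| ≤ |Y| · |X|` with the roles of the two halves exchanged gives the
other half: if `|part0 r F| ≤ |partr r F|` then `L = partr r F` (the members containing `r`, with
`r` removed) is tight, its difference family is exactly the family `X` of `r`-free differences
(`tight_partr_of_card_le`), and `F₀ \\ L = X` when `F₀ ≠ ∅` (`sdiff_part0_partr_eq_diffsX'`).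
Together: **the larger half of a tight family is always tight** (`tight_part0_or_tight_partr`).
-/

namespace PercRepro.MSTight

open Finset
open scoped FinsetFamily

variable {α : Type*} [DecidableEq α]

/-- `L \\ L ⊆ X`. -/
theorem diffs_partr_subset_diffsX (r : α) (F : Finset (Finset α)) :
    partr r F \\ partr r F ⊆ diffsX r F :=
  fun _ hE => Finset.mem_union.2 (Or.inl (Finset.mem_union.2 (Or.inr hE)))

/-- **The Daykin lever, other half.** If `F` is tight and at least as many members contain `r`
as avoid it, then the `r`-free differences number exactly `|L|` and the `r`-differences exactly
`|F₀|`. -/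
theorem card_diffsX_eq_card_partr_of_card_le {F : Finset (Finset α)} (hF : Tight F) (r : α)
    (h : (part0 r F).card ≤ (partr r F).card) :
    (diffsX r F).card = (partr r F).card ∧ (diffsY r F).card = (part0 r F).card := by
  set p := (part0 r F).card with hp
  set q := (partr r F).card with hq
  set x := (diffsX r F).card with hx
  set y := (diffsY r F).card with hy
  have hsum : x + y = p + q := by
    rw [hx, hy, ← card_diffs_eq_card_X_add_card_Y, hF, card_eq_card_part0_add_card_partr r F]
  have hxq : q ≤ x := by
    rw [hq, hx]
    exact (Finset.card_le_card_diffs _).trans (Finset.card_le_card (diffs_partr_subset_diffsX r F))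
  have hdaykin : q * p ≤ y * x := by
    have h1 := Finset.le_card_diffs_mul_card_diffs (partr r F) (part0 r F)
    have h2 : (part0 r F \\ partr r F).card ≤ x := by
      rw [hx]; exact Finset.card_le_card (sdiff_part0_partr_subset_diffsX r F)
    calc q * p = (partr r F).card * (part0 r F).card := by rw [hq, hp]
      _ ≤ (partr r F \\ part0 r F).card * (part0 r F \\ partr r F).card := h1
      _ = y * (part0 r F \\ partr r F).card := by rw [hy]; rfl
      _ ≤ y * x := Nat.mul_le_mul_left _ h2
  have hxeq : x = q := by
    have hy' : y = p + q - x := by omega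
    rw [hy'] at hdaykin
    have hx' : x ≤ p + q := by omega
    rcases Nat.lt_or_ge q x with hlt | hge
    · exfalso
      have : (p + q - x) * x < q * p := by
        have hpx : p ≤ x := h.trans hxq
        have : (p + q - x) < p := by omega
        nlinarith [Nat.sub_add_cancel hx', this, hlt, hpx]
      omega
    · omega
  exact ⟨hxeq, by omega⟩

/-- **The `r`-half is tight** when it is the larger half: `|F₀| ≤ |L|` for tight `F` gives
`Tight L` and `L \\ L = X`. -/
theorem tight_partr_of_card_le {F : Finset (Finset α)} (hF : Tight F) (r : α)
    (h : (part0 r F).card ≤ (partr r F).card) :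
    Tight (partr r F) ∧ partr r F \\ partr r F = diffsX r F := by
  obtain ⟨hx, _⟩ := card_diffsX_eq_card_partr_of_card_le hF r h
  have hsub := diffs_partr_subset_diffsX r F
  have hcard : (diffsX r F).card ≤ (partr r F \\ partr r F).card := by
    rw [hx]; exact Finset.card_le_card_diffs _
  have heq : partr r F \\ partr r F = diffsX r F := Finset.eq_of_subset_of_card_le hsub hcard
  refine ⟨?_, heq⟩
  show (partr r F \\ partr r F).card = (partr r F).card
  rw [heq, hx]

/-- When moreover some member avoids `r`: `F₀ \\ L = X`. -/
theorem sdiff_part0_partr_eq_diffsX' {F : Finset (Finset α)} (hF : Tight F) (r : α)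
    (h : (part0 r F).card ≤ (partr r F).card) (hne : (part0 r F).Nonempty) :
    part0 r F \\ partr r F = diffsX r F := by
  obtain ⟨hx, hy⟩ := card_diffsX_eq_card_partr_of_card_le hF r h
  have hp : 0 < (part0 r F).card := Finset.card_pos.2 hne
  have h1 := Finset.le_card_diffs_mul_card_diffs (partr r F) (part0 r F)
  have h2 : (partr r F).card ≤ (part0 r F \\ partr r F).card := by
    have : (part0 r F).card * (partr r F).card ≤ (part0 r F).card * (part0 r F \\ partr r F).card := by
      calc (part0 r F).card * (partr r F).card = (partr r F).card * (part0 r F).card := Nat.mul_comm _ _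
        _ ≤ (partr r F \\ part0 r F).card * (part0 r F \\ partr r F).card := h1
        _ = (part0 r F).card * (part0 r F \\ partr r F).card := by
          rw [show partr r F \\ part0 r F = diffsY r F from rfl, hy]
    exact Nat.le_of_mul_le_mul_left this hp
  apply Finset.eq_of_subset_of_card_le (sdiff_part0_partr_subset_diffsX r F)
  rw [hx]; exact h2

/-- **The larger half of a tight family is tight.** -/
theorem tight_part0_or_tight_partr {F : Finset (Finset α)} (hF : Tight F) (r : α) :
    Tight (part0 r F) ∨ Tight (partr r F) := by
  rcases le_total (partr r F).card (part0 r F).card with h | h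
  · exact Or.inl (tight_part0_of_card_le hF r h).1
  · exact Or.inr (tight_partr_of_card_le hF r h).1

end PercRepro.MSTight
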